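import Mathlib
import HarnessLib
import Literature.Probability.Percolation.SiteInterfaceWindingSigns
import Literature.Probability.Percolation.SitePercolationMeasure
import Literature.Probability.LatticeModels.TriangularLatticeProofs

/-!
# Point reflections of the triangular lattice and of its interface loops (crux `MagicFormulaT`)

Crux `Summit.CriticalPhenomena.CardyFormulaZ2.Theses.CardyMagicRigidity.MagicFormulaT`
(stmt-CriticalPhenomena-4836), line `Sketch` — helper file 1/3 of the EXACT CENTRING identity
`E_p[Σ_u θ_u] = 0` (the linear term of the twisted nesting transform vanishes identically at every
mesh for neutral charges; `CardyMagicRigidityMagicFormulaTCentring`). The symmetry behind it is the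
point reflection of `ℤ²`, `v ↦ c − v` (`Equiv.subLeft c`), which for EVERY lattice vector `c` is a
symmetry of the triangular lattice `𝕋` (its centre `triEmbed c / 2` is a site, the midpoint of an
edge, or the centre of a rhombus), of the honeycomb lattice of its faces — the up triangle of the
cell `v` goes to the down triangle of the cell `c − v − (1,1)` — and of Bernoulli site percolation
`P_p` (`sitePercolation_map_relabel`). This file is pure lattice combinatorics (no curves):

* `hexGraph_adj_reflect` — the face map `(v, j) ↦ (c − v − 1, rev j)` preserves honeycomb
  adjacency; it is an involution (`reflectFace_reflectFace`);
* `triEdgeFaces_reflect` — it intertwines the left/right faces of the darts of `𝕋`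
  (a rotation by `π` preserves orientation);
* `isSiteInterfaceLoop_reflect` — the image of an interface loop of `ω` under the face map is an
  interface loop of the reflected configuration `(Equiv.subLeft c) '' ω`;
* `measurePreserving_reflect`, `integral_comp_reflect` — `ω ↦ (Equiv.subLeft c) '' ω` preserves
  `triSitePercolation p`, so `∫ F((c − ·) '' ω) dP_p = ∫ F dP_p` for every real `F`.

No definition is introduced: the face map is written out, and as a graph homomorphism it is the
local notation `ρH[c]`. Everything is proved from tree / Mathlib material; no named fact is used.
-/

noncomputable section

namespace Summit.CriticalPhenomena.CardyFormulaZ2.Cruxes.MagicFormulaT.LineSketch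

open MeasureTheory Set
open Literature.Probability.Percolation Literature.Probability.LatticeModels

/-! ## The face reflection -/

/-- The reflected faces around the origin: reflecting `hexFace₀ j` through the origin gives
`hexFace₀ (j + 3)` (cell part and type part). -/
theorem hexFace₀_add_three (j : Fin 6) :
    hexFace₀ (j + 3) = (-(hexFace₀ j).1 - 1, Fin.rev (hexFace₀ j).2) := by
  fin_cases j <;> decide

/-- **The face reflection preserves honeycomb adjacency**: `(v, j) ↦ (c − v − 1, rev j)` maps
adjacent faces to adjacent faces (the up triangle of the cell `v` goes to the down triangle of the
cell `c − v − (1, 1)`, sharing the reflected edge). -/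
theorem hexGraph_adj_reflect (c : Site 2) {F G : HexVertex} (h : hexGraph.Adj F G) :
    hexGraph.Adj (c - F.1 - 1, Fin.rev F.2) (c - G.1 - 1, Fin.rev G.2) := by
  obtain ⟨v, j⟩ := F
  obtain ⟨w, l⟩ := G
  rw [hexGraph_adj_iff_sub] at h ⊢
  have hd : c - w - 1 - (c - v - 1) = -(w - v) := by abel
  rw [hd]
  set d := w - v with hd'
  fin_cases j <;> fin_cases l
  · exact absurd h (not_hexGraph_adj_of_snd_eq_holds _ _ rfl)
  · change hexGraph.Adj ((0 : Site 2), Fin.rev 0) (-d, Fin.rev 1)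
    simp only [Fin.rev_zero]
    change hexGraph.Adj ((0 : Site 2), 1) (-d, 0)
    rw [hexGraph_adj_iff_of_snd_eq_one]
    have h' := (hexGraph_adj_iff_of_snd_eq_zero_holds 0 d).1 h
    rcases h' with h' | h' | h'
    · exact Or.inl (by rw [h']; simp)
    · exact Or.inr (Or.inl (by rw [h']; simp))
    · exact Or.inr (Or.inr (by rw [h']; simp))
  · change hexGraph.Adj ((0 : Site 2), Fin.rev 1) (-d, Fin.rev 0)
    simp only [Fin.rev_zero]
    change hexGraph.Adj ((0 : Site 2), 0) (-d, 1)
    rw [hexGraph_adj_iff_of_snd_eq_zero_holds]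
    have h' := (hexGraph_adj_iff_of_snd_eq_one 0 d).1 h
    rcases h' with h' | h' | h'
    · exact Or.inl (by rw [h']; simp)
    · exact Or.inr (Or.inl (by rw [h']; simp))
    · exact Or.inr (Or.inr (by rw [h']; simp))
  · exact absurd h (not_hexGraph_adj_of_snd_eq_holds _ _ rfl)

/-- The face reflection through `triEmbed c / 2`, as a graph endomorphism of the honeycomb
lattice (local notation, not a definition). -/
local notation3 "ρH[" c "]" =>
  (⟨fun F : HexVertex ↦ ((c : Site 2) - F.1 - 1, Fin.rev F.2), fun h ↦ hexGraph_adj_reflect c h⟩ :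
    hexGraph →g hexGraph)

/-- The face reflection, evaluated. -/
theorem reflectHom_apply (c : Site 2) (F : HexVertex) : ρH[c] F = (c - F.1 - 1, Fin.rev F.2) := rfl

/-- The face reflection is an involution. -/
theorem reflectFace_reflectFace (c : Site 2) (F : HexVertex) : ρH[c] (ρH[c] F) = F := by
  obtain ⟨v, j⟩ := F
  simp only [reflectHom_apply, Fin.rev_rev, Prod.mk.injEq, and_true]
  abel

/-- The face reflection is injective. -/
theorem reflectHom_injective (c : Site 2) : Function.Injective (ρH[c]) :=
  Function.LeftInverse.injective (g := ρH[c]) (reflectFace_reflectFace c)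

/-- The site reflection `v ↦ c − v` is an involution on configurations: reflecting twice is the
identity. -/
theorem image_subLeft_image_subLeft (c : Site 2) (ω : Set (Site 2)) :
    (Equiv.subLeft c) '' ((Equiv.subLeft c) '' ω) = ω := by
  rw [Set.image_image]
  convert Set.image_id ω
  simp

/-- Membership in the reflected configuration. -/
theorem mem_image_subLeft_iff (c : Site 2) (ω : Set (Site 2)) (v : Site 2) :
    v ∈ (Equiv.subLeft c) '' ω ↔ c - v ∈ ω := by
  rw [Equiv.image_eq_preimage_symm, Set.mem_preimage, Equiv.subLeft_symm_apply, neg_add_eq_sub]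

/-! ## Darts of `𝕋` and their faces under the reflection -/

/-- The site reflection preserves adjacency in `𝕋`. -/
theorem triGraph_adj_reflect (c : Site 2) {x y : Site 2} (h : triGraph.Adj x y) :
    triGraph.Adj (c - x) (c - y) := by
  obtain ⟨k, rfl⟩ := exists_hexDir_eq_of_adj h
  have : c - (x + hexDir k) = (c - x) + hexDir (k + 3) := by rw [hexDir_add_three]; abel
  rw [this]
  exact triGraph_adj_add_hexDir _ _

/-- The faces of a translated-table face under the reflection: `ρ (hexFace x j) = hexFace (c − x) (j + 3)`. -/
theorem reflectHom_hexFace (c x : Site 2) (j : Fin 6) : ρH[c] (hexFace x j) = hexFace (c - x) (j + 3) := by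
  rw [reflectHom_apply]
  change ((c - (x + (hexFace₀ j).1) - 1, Fin.rev (hexFace₀ j).2) : HexVertex) =
    (c - x + (hexFace₀ (j + 3)).1, (hexFace₀ (j + 3)).2)
  rw [hexFace₀_add_three]
  simp only [Prod.mk.injEq, and_true]
  abel

/-- **The reflection intertwines left and right faces of darts**: for a dart `x → y` of `𝕋`, the
faces of the reflected dart `c − x → c − y` are the reflected faces, in the same order (a rotation
by `π` preserves the orientation of the plane). -/
theorem triEdgeFaces_reflect (c : Site 2) (e : triGraph.Dart) :
    triEdgeFaces ⟨(c - e.fst, c - e.snd), triGraph_adj_reflect c e.adj⟩ =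
      (ρH[c] (triEdgeFaces e).1, ρH[c] (triEdgeFaces e).2) := by
  obtain ⟨⟨x, y⟩, hxy⟩ := e
  have hxy' : triGraph.Adj x y := hxy
  obtain ⟨k, hk⟩ := exists_hexDir_eq_of_adj hxy'
  subst hk
  have h1 : triEdgeFaces ⟨(x, x + hexDir k), hxy⟩ = (hexFace x (k + 1), hexFace x k) :=
    triEdgeFaces_hexDir x k
  have hrefl : c - (x + hexDir k) = (c - x) + hexDir (k + 3) := by rw [hexDir_add_three]; abel
  have h2 : triEdgeFaces ⟨(c - x, c - (x + hexDir k)), triGraph_adj_reflect c hxy⟩ =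
      (hexFace (c - x) (k + 3 + 1), hexFace (c - x) (k + 3)) := by
    have hd : (⟨(c - x, c - (x + hexDir k)), triGraph_adj_reflect c hxy⟩ : triGraph.Dart) =
        ⟨(c - x, c - x + hexDir (k + 3)), triGraph_adj_add_hexDir (c - x) (k + 3)⟩ := by
      apply SimpleGraph.Dart.ext
      exact Prod.ext rfl hrefl
    rw [hd]
    exact triEdgeFaces_hexDir (c - x) (k + 3)
  change triEdgeFaces ⟨(c - x, c - (x + hexDir k)), triGraph_adj_reflect c hxy⟩ =
    (ρH[c] (triEdgeFaces ⟨(x, x + hexDir k), hxy⟩).1, ρH[c] (triEdgeFaces ⟨(x, x + hexDir k), hxy⟩).2)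
  rw [h2, h1, reflectHom_hexFace, reflectHom_hexFace, add_right_comm k 3 1]

/-! ## Interface loops under the reflection -/

/-- **The reflection of an interface loop is an interface loop of the reflected configuration.**
Every dart of the reflected walk crosses the reflected edge of `𝕋`, whose open endpoint is still on
its left. -/
theorem isSiteInterfaceLoop_reflect (c : Site 2) {ω : SiteConfig (Site 2)} {f : HexVertex}
    {γ : hexGraph.Walk f f} (hγ : IsSiteInterfaceLoop ω γ) :
    IsSiteInterfaceLoop ((Equiv.subLeft c) '' ω) (γ.map ρH[c]) := by
  refine ⟨(SimpleGraph.Walk.isCycle_map_iff_of_injective (reflectHom_injective c)).2 hγ.isCycle,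
    fun d hd ↦ ?_⟩
  rw [SimpleGraph.Walk.darts_map, List.mem_map] at hd
  obtain ⟨d₀, hd₀, rfl⟩ := hd
  obtain ⟨e, he, hopen, hclosed⟩ := hγ.2 d₀ hd₀
  refine ⟨⟨(c - e.fst, c - e.snd), triGraph_adj_reflect c e.adj⟩, ?_, ?_, ?_⟩
  · rw [triEdgeFaces_reflect, he]
    rfl
  · change c - e.fst ∈ (Equiv.subLeft c) '' ω
    rw [mem_image_subLeft_iff, sub_sub_cancel]
    exact hopen
  · change c - e.snd ∉ (Equiv.subLeft c) '' ω
    rw [mem_image_subLeft_iff, sub_sub_cancel]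
    exact hclosed

/-- The support of the twice-reflected walk is the original support. -/
theorem support_map_reflect_map_reflect (c : Site 2) {f g : HexVertex} (γ : hexGraph.Walk f g) :
    ((γ.map ρH[c]).map ρH[c]).support = γ.support := by
  rw [SimpleGraph.Walk.support_map, SimpleGraph.Walk.support_map, List.map_map]
  convert List.map_id γ.support
  funext F
  exact reflectFace_reflectFace c F

/-! ## The reflection preserves site percolation -/

/-- **`ω ↦ (Equiv.subLeft c) '' ω` preserves `triSitePercolation p`** (relabelling invariance of
the product measure along the bijection `v ↦ c − v` of the index set). -/
theorem measurePreserving_reflect (c : Site 2) (p : unitInterval) :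
    MeasurePreserving (SiteConfig.relabel (Equiv.subLeft c)) (triSitePercolation p)
      (triSitePercolation p) :=
  ⟨(SiteConfig.relabel (Equiv.subLeft c)).measurable, sitePercolation_map_relabel _ _⟩

/-- Change of variables under the reflection: `∫ F((c − ·) '' ω) dP_p = ∫ F dP_p` for EVERY
real function `F` on configurations (no measurability needed: the reflection is a measurable
equivalence preserving the measure). -/
theorem integral_comp_reflect (c : Site 2) (p : unitInterval) (F : SiteConfig (Site 2) → ℝ) :
    ∫ ω, F ((Equiv.subLeft c) '' ω) ∂(triSitePercolation p) = ∫ ω, F ω ∂(triSitePercolation p) :=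
  (measurePreserving_reflect c p).integral_comp' F


/-- **Sub-goal `latticeReflection_integral_comp` (helper file 1/3 of the exact centring identity of
line `Sketch`, crux `MagicFormulaT`): `P_p` on `𝕋` is invariant under every point reflection
`v ↦ c − v`, as a change of variables valid for all real functions of the configuration.** -/
theorem latticeReflection_integral_comp : ∀ (c : Site 2) (p : unitInterval) (F : SiteConfig (Site 2) → ℝ),
    ∫ ω, F ((Equiv.subLeft c) '' ω) ∂(triSitePercolation p) = ∫ ω, F ω ∂(triSitePercolation p) :=
  integral_comp_reflect

end Summit.CriticalPhenomena.CardyFormulaZ2.Cruxes.MagicFormulaT.LineSketch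

end
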